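import Summits.CriticalPhenomena.PercolationContinuityZ3.Theorems.PercNearOneGluingNoHeavyLowerTailAntitheticSliceNoCycle
import HarnessLib

/-!
# `NoHeavyLowerTail` (stmt-CriticalPhenomena-4575) — antithetic cluster pairs: tools for the PEELING identity (sinks ⟶ bicluster
# avoidance), prim-hp-2 gen 31/36 (MEMO-gen31 §1a–c, MEMO-gen36 §6)

Support file (`--supports stmt-CriticalPhenomena-4575`, hull-port prover `prim-hp-2`, gen 36).  No named facts, no sorries; standard axioms.
The `def`s `Antithetic.Peel.{delta, tset, tsum}` name the antithetic functional `Δ`, the constraint set "no vertex of `R` in both clusters,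
no vertex of `X` in either" and the constrained sum `T_E(R,X) = Σ_{tset} Δ` (so `T_E(R,∅) = BIC_E(R)` and `T_E(∅,X) = SC(E,X)`).

PEELING (MEMO-gen31 §1): a sink `x ∈ X` is removed by summing out the colours of the edges at `x`: with `E' = E ∖ {edges at x}` and `N` the
neighbours of `x`,  `2^{|N|} · T_E(R,X) = Σ_{F ⊆ N} T_{E'}(R ∪ (N∖F), (X∖x) ∪ F)`  (file `…AntitheticPeel`).  This file supplies the graph facts
and the "slab" sums it needs:
* `Peel.reachable_sdiff_iff`, `Peel.openEdgeCluster_sdiff_eq` — if `x` is not reached, deleting the edges at `x` changes neither reachability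
  from `s` nor the edge cluster;
* `Peel.not_reachable_iff_nbrs` — `x ≠ s` is not reached iff no neighbour `u` joined to `x` by an open edge is reached avoiding `x`;
* `Peel.sum_slab_eq`, `Peel.sum_eq_card_mul_sum_slab` — for a function of the colouring that ignores the edges `xu (u ∈ N)`, the sum over the
  "slab" `{ω : xu ∈ ω ↔ u ∈ F}` does not depend on `F ⊆ N`, hence equals `2^{-|N|}` times the full sum.
[cite: VandenbergHaggstromKahn2005, §1 p. 3 (open cluster `C_s`)]
-/

noncomputable section

namespace Summit.CriticalPhenomena.PercolationContinuityZ3.Theorems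

open Literature.Probability.Percolation
open scoped Classical symmDiff

namespace Antithetic

namespace Peel

variable {V : Type*}

/-- The antithetic functional `Δ_E(ω) = (F(C_s(ω∩E)) − F(C_s(ωᶜ∩E)))·(G(C_s(ω∩E)) − G(C_s(ωᶜ∩E)))`. [this work] -/
def delta (F G : Set (Sym2 V) → ℝ) (E : Set (Sym2 V)) (s : V) (ω : Set (Sym2 V)) : ℝ :=
  (F (openEdgeCluster (ω ∩ E) s) - F (openEdgeCluster (ωᶜ ∩ E) s)) *
    (G (openEdgeCluster (ω ∩ E) s) - G (openEdgeCluster (ωᶜ ∩ E) s))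

/-- The constraint set of `T_E(R,X)`: colourings in which no vertex of `R` is joined to `s` in both colours and no vertex of `X` in either.
[this work] -/
def tset [Fintype V] (E : Set (Sym2 V)) (s : V) (R X : Set V) : Finset (Set (Sym2 V)) :=
  Finset.univ.filter fun ω =>
    (∀ r ∈ R, ¬ ((openGraph (ω ∩ E)).Reachable s r ∧ (openGraph (ωᶜ ∩ E)).Reachable s r)) ∧
      (∀ x ∈ X, ¬ (openGraph (ω ∩ E)).Reachable s x ∧ ¬ (openGraph (ωᶜ ∩ E)).Reachable s x)

/-- `T_E(R,X) = Σ_{ω ∈ tset} Δ_E(ω)` (MEMO-gen31 §1b); `T_E(R,∅) = BIC_E(R)`, `T_E(∅,X)` = the antithetic BHK sum SC(E,X). [this work] -/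
def tsum [Fintype V] (F G : Set (Sym2 V) → ℝ) (E : Set (Sym2 V)) (s : V) (R X : Set V) : ℝ :=
  ∑ ω ∈ tset E s R X, delta F G E s ω

/-- Membership in the constraint set. [this work] -/
theorem mem_tset [Fintype V] (E : Set (Sym2 V)) (s : V) (R X : Set V) (ω : Set (Sym2 V)) :
    ω ∈ tset E s R X ↔
      (∀ r ∈ R, ¬ ((openGraph (ω ∩ E)).Reachable s r ∧ (openGraph (ωᶜ ∩ E)).Reachable s r)) ∧
        (∀ x ∈ X, ¬ (openGraph (ω ∩ E)).Reachable s x ∧ ¬ (openGraph (ωᶜ ∩ E)).Reachable s x) := by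
  simp only [tset, Finset.mem_filter, Finset.mem_univ, true_and]

section Graph

variable (η : Set (Sym2 V)) (s x : V)

/-- If `x` is not reached from `s`, deleting the pairs at `x` does not change reachability from `s`. [folklore] -/
theorem reachable_sdiff_iff (hx : ¬ (openGraph η).Reachable s x) (v : V) :
    (openGraph (η \ {e | x ∈ e})).Reachable s v ↔ (openGraph η).Reachable s v := by
  constructor
  · exact fun h => h.mono (SimpleGraph.fromEdgeSet_mono fun _ he => he.1)
  · rintro ⟨p⟩
    refine ⟨p.transfer _ fun e he => ?_⟩
    have heG := p.edges_subset_edgeSet he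
    rw [openGraph, SimpleGraph.edgeSet_fromEdgeSet] at heG ⊢
    refine ⟨⟨heG.1, fun hxe => hx ?_⟩, heG.2⟩
    obtain ⟨y, hy⟩ := Sym2.mem_iff_exists.1 hxe
    rw [hy] at he
    exact reachable_of_mem_support p (p.fst_mem_support_of_mem_edges he)

/-- If `x` is not reached from `s`, deleting the pairs at `x` does not change the open edge cluster of `s`.
[cite: VandenbergHaggstromKahn2005, §1 p. 3 (open cluster `C_s`)] -/
theorem openEdgeCluster_sdiff_eq (hx : ¬ (openGraph η).Reachable s x) :
    openEdgeCluster (η \ {e | x ∈ e}) s = openEdgeCluster η s := by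
  ext e
  rw [mem_openEdgeCluster_iff, mem_openEdgeCluster_iff]
  constructor
  · rintro ⟨he, hd, hr⟩
    exact ⟨he.1, hd, fun v hv => (reachable_sdiff_iff η s x hx v).1 (hr v hv)⟩
  · rintro ⟨he, hd, hr⟩
    exact ⟨⟨he, fun hxe => hx (hr x hxe)⟩, hd, fun v hv => (reachable_sdiff_iff η s x hx v).2 (hr v hv)⟩

/-- **Peeling a vertex**: `x ≠ s` is NOT reached from `s` iff for every open pair `xu` (`u ≠ x`) the vertex `u` is not reached from `s` avoiding
`x`.  (⇐ uses a path: its last edge into `x` comes from a vertex reached avoiding `x`.) [this work] -/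
theorem not_reachable_iff_nbrs (hxs : x ≠ s) :
    ¬ (openGraph η).Reachable s x ↔ ∀ u, s(x, u) ∈ η → u ≠ x → ¬ (openGraph (η \ {e | x ∈ e})).Reachable s u := by
  constructor
  · intro hx u hxu hux hu
    apply hx
    have hu' : (openGraph η).Reachable s u := hu.mono (SimpleGraph.fromEdgeSet_mono fun _ he => he.1)
    have hadj : (openGraph η).Adj u x := by
      rw [openGraph_adj, Sym2.eq_swap]
      exact ⟨hxu, hux⟩
    exact hu'.trans hadj.reachable
  · rintro h ⟨p⟩
    have hq := p.reverse.bypass_isPath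
    revert hq
    generalize p.reverse.bypass = q
    intro hq
    cases q with
    | nil => exact hxs rfl
    | @cons _ u _ hadj q' =>
      rw [SimpleGraph.Walk.cons_isPath_iff] at hq
      rw [openGraph_adj] at hadj
      refine h u hadj.1 hadj.2.symm ⟨(q'.transfer (openGraph (η \ {e | x ∈ e})) fun e he => ?_).reverse⟩
      have heG := q'.edges_subset_edgeSet he
      rw [openGraph, SimpleGraph.edgeSet_fromEdgeSet] at heG ⊢
      refine ⟨⟨heG.1, fun hxe => hq.2 ?_⟩, heG.2⟩
      obtain ⟨y, hy⟩ := Sym2.mem_iff_exists.1 hxe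
      rw [hy] at he
      exact q'.fst_mem_support_of_mem_edges he

end Graph

section Slab

variable [Fintype V] (x : V) (N : Finset V)

/-- The reflection `ω ↦ ω ∆ D` across a set `D` of pairs at `x` maps one slab `{ω : xu ∈ ω ↔ u ∈ F}` onto another; a summand that ignores the
pairs `xu (u ∈ N)` therefore has the same sum over every slab. [folklore] -/
theorem sum_slab_eq (h : Set (Sym2 V) → ℝ) (hh : ∀ ω D : Set (Sym2 V), D ⊆ {e | ∃ u ∈ N, e = s(x, u)} → h (ω ∆ D) = h ω)
    (F F' : Finset V) :
    ∑ ω ∈ Finset.univ.filter (fun ω : Set (Sym2 V) => ∀ u ∈ N, s(x, u) ∈ ω ↔ u ∈ F), h ω =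
      ∑ ω ∈ Finset.univ.filter (fun ω : Set (Sym2 V) => ∀ u ∈ N, s(x, u) ∈ ω ↔ u ∈ F'), h ω := by
  set D : Set (Sym2 V) := {e | ∃ u ∈ N, e = s(x, u) ∧ (u ∈ F ↔ u ∉ F')} with hD
  have hDsub : D ⊆ {e | ∃ u ∈ N, e = s(x, u)} := fun e ⟨u, hu, he, _⟩ => ⟨u, hu, he⟩
  have hmemD : ∀ u ∈ N, (s(x, u) ∈ D ↔ (u ∈ F ↔ u ∉ F')) := by
    intro u hu
    constructor
    · rintro ⟨u', -, he, h'⟩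
      have : u = u' := by
        rcases Sym2.eq_iff.1 he with ⟨-, h⟩ | ⟨h1, h2⟩
        · exact h
        · exact h2.trans h1
      subst this
      exact h'
    · exact fun h' => ⟨u, hu, rfl, h'⟩
  have hinv : Function.Involutive fun ω : Set (Sym2 V) => ω ∆ D := fun ω => symmDiff_symmDiff_cancel_right _ _
  rw [Finset.sum_filter, Finset.sum_filter]
  rw [← Fintype.sum_equiv (Function.Involutive.toPerm _ hinv) (fun ω => if (∀ u ∈ N, s(x, u) ∈ ω ∆ D ↔ u ∈ F) then h (ω ∆ D) else 0)
    (fun ω => if (∀ u ∈ N, s(x, u) ∈ ω ↔ u ∈ F) then h ω else 0) (fun ω => rfl)]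
  refine Finset.sum_congr rfl fun ω _ => ?_
  rw [hh ω D hDsub]
  have key : (∀ u ∈ N, s(x, u) ∈ ω ∆ D ↔ u ∈ F) ↔ (∀ u ∈ N, s(x, u) ∈ ω ↔ u ∈ F') := by
    refine forall₂_congr fun u hu => ?_
    rw [Set.mem_symmDiff]
    have := hmemD u hu
    tauto
  simp only [key]

/-- Consequently the full sum is `2^{|N|}` times the sum over any one slab. [folklore] -/
theorem sum_eq_card_mul_sum_slab (h : Set (Sym2 V) → ℝ)
    (hh : ∀ ω D : Set (Sym2 V), D ⊆ {e | ∃ u ∈ N, e = s(x, u)} → h (ω ∆ D) = h ω) (F : Finset V) :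
    ∑ ω : Set (Sym2 V), h ω =
      (2 : ℝ) ^ N.card * ∑ ω ∈ Finset.univ.filter (fun ω : Set (Sym2 V) => ∀ u ∈ N, s(x, u) ∈ ω ↔ u ∈ F), h ω := by
  have hfib := Finset.sum_fiberwise_of_maps_to (s := (Finset.univ : Finset (Set (Sym2 V)))) (t := N.powerset)
    (g := fun ω => N.filter fun u => s(x, u) ∈ ω) (fun ω _ => Finset.mem_powerset.2 (Finset.filter_subset _ _)) h
  rw [← hfib]
  have hslab : ∀ G ∈ N.powerset,
      (Finset.univ.filter fun ω : Set (Sym2 V) => (N.filter fun u => s(x, u) ∈ ω) = G) =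
        Finset.univ.filter fun ω : Set (Sym2 V) => ∀ u ∈ N, s(x, u) ∈ ω ↔ u ∈ G := by
    intro G hG
    rw [Finset.mem_powerset] at hG
    refine Finset.filter_congr fun ω _ => ?_
    rw [Finset.ext_iff]
    constructor
    · intro h' u hu
      have := h' u
      rw [Finset.mem_filter] at this
      exact ⟨fun hm => this.1 ⟨hu, hm⟩, fun hG' => (this.2 hG').2⟩
    · intro h' u
      rw [Finset.mem_filter]
      exact ⟨fun hm => (h' u hm.1).1 hm.2, fun hG' => ⟨hG hG', (h' u (hG hG')).2 hG'⟩⟩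
  rw [Finset.sum_congr rfl fun G hG => by rw [hslab G hG, sum_slab_eq x N h hh G F], Finset.sum_const, Finset.card_powerset,
    nsmul_eq_mul]
  push_cast
  ring

end Slab

end Peel

end Antithetic

end Summit.CriticalPhenomena.PercolationContinuityZ3.Theorems
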